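import Mathlib
import Summits.ResolutionOfSingularities.ResolutionOfSingularities.Theorems.WildQuotientsKiralyLutkebohmertMonogenous
import Literature.AlgebraicGeometry.Resolution.KiralyLutkebohmertCriterionProofs
import HarnessLib

/-!
# Király–Lütkebohmert (ANT 7 (2013)), §3: the fixed ring is local, and the case `𝔪_B = 𝔪_A·B` of
# Conjecture 9 (monogenous residue extension ⇒ monogenous ⇒ principal augmentation)

Route `ResolutionOfSingularities/WildQuotients`; helper toward the depth-0 / kill-criterion dictionary
of the crux `CyclicQuotientFourfolds` (stmt-ResolutionOfSingularities-17941, research stub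
`stub_reachLowerInFX`). F. Király, W. Lütkebohmert, *Group actions of prime order on local normal
rings*, Algebra & Number Theory 7 (2013) 63–74, §3 (proof of Conjecture 9 for `p = 3`, second case:
«If `k_A → k_B` is not an isomorphism, then we must have `𝔪_B = B𝔪_A` … the field extension
`k_A → k_B` is monogenous, and hence `A → B` is monogenous due to the lemma of Nakayama»).

* `kl_mem_maximalIdeal_fixed_iff` — for a local ring `B` and a ring automorphism `σ`, the fixed
  subring `A = B^σ` (local: the tree's `Literature…isLocalRing_invariants`) has `𝔪_A = A ∩ 𝔪_B`.
* `kl_adjoin_eq_top_of_residue` — **Nakayama step of §3**: if `B` is module-finite over `A`,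
  `𝔪_B ⊆ 𝔪_A·B` (typed: `𝔪_B` is generated by `σ`-invariant elements), and the residue ring `B/𝔪_B`
  is generated over `A` by the class of one element `θ` (every `b` is congruent mod `𝔪_B` to an
  element of `A[θ]`), then `B = A[θ]`.
* `kl_augIdeal_eq_span_singleton_of_residue` — … hence the augmentation ideal is `(σ θ − θ)`
  (Thm. 2 (b) ⇒ (a)): Conjecture 9's conclusion in the case `𝔪_B = 𝔪_A B` with monogenous residue
  field extension (automatic when `[k_B : k_A]` is prime). [cite: KiralyLutkebohmert2013, §3 p. 71]

[OURS · crux stmt-ResolutionOfSingularities-17941 · helper (def-free), printed argument of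
KiralyLutkebohmert2013 §3; counted 0; AI-level work, weaker than expert review.]
-/

-- single-problem summit: the doubled namespace component `ResolutionOfSingularities` is forced
set_option linter.dupNamespace false

open IsLocalRing Literature.AlgebraicGeometry.Resolution

namespace Summit.ResolutionOfSingularities.ResolutionOfSingularities.Theorems

variable {B : Type*} [CommRing B]

/-- The maximal ideal of the fixed ring is the trace of `𝔪_B`: `a ∈ 𝔪_A ↔ (a : B) ∈ 𝔪_B`. [folklore] -/
theorem kl_mem_maximalIdeal_fixed_iff [IsLocalRing B] (σ : B ≃+* B)
    (a : (σ : B →+* B).eqLocus (RingHom.id B)) :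
    (haveI := isLocalRing_invariants σ; a ∈ maximalIdeal ((σ : B →+* B).eqLocus (RingHom.id B))) ↔
      (a : B) ∈ maximalIdeal B := by
  haveI := isLocalRing_invariants σ
  rw [IsLocalRing.mem_maximalIdeal, IsLocalRing.mem_maximalIdeal, mem_nonunits_iff, mem_nonunits_iff,
    not_iff_not]
  exact ⟨fun h => h.map ((σ : B →+* B).eqLocus (RingHom.id B)).subtype,
    fun h => isUnit_invariants_of_isUnit σ h⟩

/-- **Nakayama step of Király–Lütkebohmert §3**: let `B` be local and module-finite over the fixed
ring `A = B^σ`, with `𝔪_B ⊆ 𝔪_A·B` (i.e. `𝔪_B = 𝔪_A B`; typed: `𝔪_B` is generated as an ideal by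
`σ`-invariant elements) and residue ring generated over `A` by the class of `θ` (every element of `B` is congruent modulo `𝔪_B` to an element of `A[θ]`). Then
`B = A[θ]` is monogenous. [cite: KiralyLutkebohmert2013, §3 p. 71 («hence `A → B` is monogenous due to the lemma of Nakayama»)] -/
theorem kl_adjoin_eq_top_of_residue [IsLocalRing B] (σ : B ≃+* B)
    [Module.Finite ((σ : B →+* B).eqLocus (RingHom.id B)) B] (θ : B)
    (hres : ∀ b : B, ∃ f ∈ Algebra.adjoin ((σ : B →+* B).eqLocus (RingHom.id B)) {θ},
      b - f ∈ maximalIdeal B)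
    (hm : maximalIdeal B ≤ Ideal.span {a : B | σ a = a ∧ a ∈ maximalIdeal B}) :
    Algebra.adjoin ((σ : B →+* B).eqLocus (RingHom.id B)) {θ} = ⊤ := by
  classical
  set A : Subring B := (σ : B →+* B).eqLocus (RingHom.id B) with hA_def
  haveI : IsLocalRing A := isLocalRing_invariants σ
  let N : Submodule A B := Subalgebra.toSubmodule (Algebra.adjoin A {θ})
  -- `𝔪_A • B` is stable under multiplication by `B`
  have hstab : ∀ x ∈ maximalIdeal A • (⊤ : Submodule A B), ∀ b : B,
      b * x ∈ maximalIdeal A • (⊤ : Submodule A B) := by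
    intro x hx b
    refine Submodule.smul_induction_on (p := fun x => b * x ∈ maximalIdeal A • (⊤ : Submodule A B)) hx
      (fun a ha y _ => ?_) (fun x y hx hy => ?_)
    · have e : b * (a • y) = a • (b * y) := by
        rw [Subring.smul_def, Subring.smul_def, smul_eq_mul, smul_eq_mul]; ring
      rw [e]
      exact Submodule.smul_mem_smul ha Submodule.mem_top
    · rw [mul_add]; exact add_mem hx hy
  -- `𝔪_B ⊆ 𝔪_A • B`
  have hmB : ∀ m ∈ maximalIdeal B, m ∈ maximalIdeal A • (⊤ : Submodule A B) := by
    intro m hm'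
    have hm'' := hm hm'
    clear hm'
    induction hm'' using Submodule.span_induction with
    | mem a ha =>
      obtain ⟨hfix, hmax⟩ := ha
      have hai : (⟨a, hfix⟩ : A) ∈ maximalIdeal A := (kl_mem_maximalIdeal_fixed_iff σ ⟨a, hfix⟩).mpr hmax
      have e : a = (⟨a, hfix⟩ : A) • (1 : B) := by rw [Subring.smul_def, smul_eq_mul, mul_one]
      rw [e]
      exact Submodule.smul_mem_smul hai Submodule.mem_top
    | zero => exact zero_mem _
    | add x y _ _ hx hy => exact add_mem hx hy
    | smul b x _ hx => exact hstab x hx b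
  -- `B ≤ A[θ] + 𝔪_A • B`
  have hle : (⊤ : Submodule A B) ≤ N ⊔ maximalIdeal A • (⊤ : Submodule A B) := by
    intro b _
    obtain ⟨f, hf, hbf⟩ := hres b
    have hb : b = f + (b - f) := by ring
    rw [hb]
    exact add_mem (Submodule.mem_sup_left hf) (Submodule.mem_sup_right (hmB _ hbf))
  have htop : (⊤ : Submodule A B) ≤ N :=
    Submodule.le_of_le_smul_of_le_jacobson_bot Module.Finite.fg_top (maximalIdeal_le_jacobson ⊥) hle
  rw [eq_top_iff]
  intro b _
  exact htop Submodule.mem_top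

/-- **Conjecture 9 of Király–Lütkebohmert in the case `𝔪_B = 𝔪_A·B` with monogenous residue
extension**: under the hypotheses of `kl_adjoin_eq_top_of_residue` the augmentation ideal
`(σ c − c : c ∈ B)` is principal, generated by `σ θ − θ` (monogenous ⇒ Thm. 2 (b) ⇒ (a)). The
residue extension is monogenous e.g. when `[k_B : k_A]` is prime, as in the printed case `p = 3`.
[cite: KiralyLutkebohmert2013, §3 p. 71, Thm. 2 (b)⇒(a)] -/
theorem kl_augIdeal_eq_span_singleton_of_residue [IsLocalRing B] (σ : B ≃+* B)
    [Module.Finite ((σ : B →+* B).eqLocus (RingHom.id B)) B] (θ : B)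
    (hres : ∀ b : B, ∃ f ∈ Algebra.adjoin ((σ : B →+* B).eqLocus (RingHom.id B)) {θ},
      b - f ∈ maximalIdeal B)
    (hm : maximalIdeal B ≤ Ideal.span {a : B | σ a = a ∧ a ∈ maximalIdeal B}) :
    Ideal.span (Set.range fun c : B => σ c - c) = Ideal.span {σ θ - θ} :=
  kl_augIdeal_eq_span_singleton_of_adjoin_eq_top σ θ (kl_adjoin_eq_top_of_residue σ θ hres hm)

end Summit.ResolutionOfSingularities.ResolutionOfSingularities.Theorems
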